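import Literature.MathematicalPhysics.QuantumFieldTheory.BalabanImbrieJaffe1984to88.BIJ88Eq5145CornerModel
import Literature.MathematicalPhysics.QuantumFieldTheory.BalabanImbrieJaffe1984to88.BIJ88EffectiveActionGauss308

/-!
# `BalabanImbrieJaffe1984to88.BIJ88Eq5145CornerUrsell` — T. Bałaban, J. Imbrie, A. Jaffe, *Effective action and cluster properties of the
abelian Higgs model*, Commun. Math. Phys. **114** (1988) 257–315 [BalabanImbrieJaffe1988]: Sect. 5.14, p. 312 [PDF 56], **(5.14.5) ON THE
§5.13 GAUSSIAN MODEL WITH (5.14.1)–(5.14.2) AT `t = 0` BY NAME** (rows `C2.Eq5.14.5`, `C2.Eq5.14.1-5.14.2`): the sequel of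
`BIJ88Eq5145CornerModel.eq5145_zG` ((5.14.5) for the p. 308 cube factors `u_i·F_i`, `z`, `z_F/z` concrete, `z > 0` proved, per region only
`hlogz`/`hrem`/`h311` displayed). Since `z(Λ₁₂)(Λ₁₂′)` IS the `z_t` at `t = 1` of p36's p. 308 family of the slots located in `Λ₁₂` under the
law of the fields of `Λ₁₂` at the corner `1_{Λ₁₂′}` (`BIJ88Eq5145CornerModel.zG_fD_empty_eq_ztIn`), the per-region `hlogz` — *"−log z₁(Λ₁₂) =
𝒫̃_{k+1}(Λ₁₂) + ℛ_k(Λ₁₂)"*, the `t = 0` end of (5.14.2) — is DISCHARGED BY NAME by p36 g11's `effectiveAction_eq_pertP_add_remR_ursell`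
((5.14.1)–(5.14.2) at `t = 0` for centred jointly Gaussian slot fields on a probability space, `⟨…;…⟩_t` := the cumulants of the slot
moments): `𝒫̃ := pertP(log z_t)`, `ℛ := (n̄+1)·remR(t ↦ Σ_γ uᵀ_{γ,t})`.

HONEST FRAMING (cell `lit-balaban`, verbatim): statement-level skeleton of published theorems with citation tags; proofs where landed; nothing here is a claim about the Yang–Mills mass gap.

PDF held: `paper:balaban1988-cmp114-bij-abelian-higgs-effective-action` (journal page = PDF page + 256); pp. 308–312 = PDF 52–56, read this
session. (5.14.2) p. 308 [PDF 52], verbatim: *"The effective action is computed from the formula −log z₁(Λ₁₂^{(k)}) = 𝒫̃_{k+1}(Λ₁₂^{(k)}) +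
ℛ_k(Λ₁₂^{(k)}), where z_t(Λ₁₂^{(k)}) = ⟨χ′_{Λ₁₂^{(k)},t} e^{−tṼ^{(k)}(Λ₁₂^{(k)})}⟩₁"*; (5.14.5) p. 312 quoted in `BIJ88Eq5145CornerModel`.

**What is proved (0 `sorry`, standard axioms, 0 new `Prop` facts; 1 notational `abbrev` `cubeIn`).** **`eq5145_zG_ursell`** — (5.14.5) on the model
(`e^{−V_const}·⟨Π_{i∈W} u_i F_i⟩_{1,W} = Σ_{ρ admissible outer} (Π g₁)·(z_F/z)(Λ₁₂)(Λ₁₂′)·exp(−𝒫^L − Σ_X (W₆′ + W₆″))`) with, per region,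
`pert := pertP(log z_t(Λ₁₂)(Λ₁₂′))` and `rem := (n̄+1)·remR(t ↦ Σ_γ uᵀ_{γ,t})` FED BY NAME; displayed per region: the slot fields `Φ_b ∘ ext`
(`□(b) ⊂ Λ₁₂`) jointly Gaussian and centred under the law of `Λ₁₂` at `1_{Λ₁₂′}` (for the linear fields of the print: p36's announced
`BIJ88EffectiveActionGauss308`), a slot located in each region (`s₀`), `p > 1/2`, `e_k < e^{−1}`, `n̄ + 1` derivative labels, `hrem`
(`ℛ = Σ_X W₆′(X)`: p. 310 display 4 with the cumulants = p25's `Tsum` modulo the leaf (5.14.4) — p36's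
`ursell_slotMoment_fieldLaw_eq_Tsum_of_ineq5144`, p25's `remR_eq_sum_W6'`) and `h311`; **`eq5145_zG_ursell_extraction`** — also p. 311 by name
(p31's `extraction311`), modulo the displayed identification `hpert : pertP(log z_t) = p31's pert` of the two currencies of `𝒫̃_{k+1}`
((5.14.2)'s derivatives of `log z_t` at `0` vs. p. 311's diagram data). FOR THE LINEAR SLOT FIELDS OF THE PRINT (p. 308: the `Φ_b` are
components of `(I − Q_s*Q)A^{(k)}` and of `φ^{(k)″}`): `hasGaussianLaw_slotFields_regionLaw` (the located linear slot fields are jointly Gaussian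
under the law of any region at any corner — p36 g12's `hasGaussianLaw_slotFields` for `Δ_{1_Λ}`), `integral_slotField_regionLaw` (their means
= values at the region's mean field `(Δ_{1_Λ}|_X)⁻¹ℱ|_X`), **`eq5145_zG_linear`** — (5.14.5) on the model with (5.13.4), (5.14.1), (5.14.2) at
`t = 0`, *"z_F = (z_F/z)·z"*, `z > 0` and the Gaussianity ALL by name / proved; displayed per region: a slot in the region (`s₀`), the
mean-field condition `hcen` (p36's), `hrem`, `h311` — and **`eq5145_zG_linear_noSource`** (`ℱ = 0`: `hcen` automatic; displayed `s₀`, `hrem`,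
`h311` only); **`eq5145_zG_linear_Tsum_of_ineq5144`** — the same with `ℛ` as the CONNECTED-GRAPH SERIES of display 3 (p25's `Tsum` over the
virtual supports of the region) via p36 g12's `effectiveAction_fieldLaw_eq_pertP_add_remR_Tsum_of_ineq5144` for the located slot data
(`cubeIn`, `ztIn_eq_zG_located`, `interpForm_abutting`), MODULO THE LEAF (5.14.4) (`h5144`: r16's typed `Ineq5144` for the prime-dropped
activities of every assignment at every `t ∈ (0,1]`, gen 5's regime).
HONEST SCOPE: as in `BIJ88Eq5145CornerModel` (cube-local observables; the IBP structure of `z_F/z` not re-derived on the model; the located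
imprecision of (5.14.1) carried verbatim); the `(n̄+1)!` of the printed remainder is p36's located slip GAPS G-C2-p36-06 (`n̄!`). Imports
`BIJ88Eq5145CornerModel` (p25 g13), `BIJ88EffectiveActionGauss308` (p36 g12); modifies nothing. NOT summit progress; NOT continuum; NOT Clay. Cell
`lit-balaban` Phase 2, seat p25 gen 13 (row owner r16, referee ref-5).
-/

noncomputable section

open Finset MeasureTheory ProbabilityTheory
open Literature.Probability.LatticeModels (ursellOf)
open Literature.MathematicalPhysics.QuantumFieldTheory.BalabanImbrieJaffe1984to88.BIJ88DirichletForms305 (interpForm interpForm_apply)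
open Literature.MathematicalPhysics.QuantumFieldTheory.BalabanImbrieJaffe1984to88.BIJ88PolymerRep5134 (g1 IsAdmissible corner)
open Literature.MathematicalPhysics.QuantumFieldTheory.BalabanImbrieJaffe1984to88.BIJ88PolymerRep5134Gauss (ext obs prec src expect zG)
open Literature.MathematicalPhysics.QuantumFieldTheory.BalabanImbrieJaffe1984to88.BIJ88Resummation5141 (outer lam12 lam12_subset)
open Literature.MathematicalPhysics.QuantumFieldTheory.BalabanImbrieJaffe1984to88.BIJ88Resummation5141Adm (lam12')
open Literature.MathematicalPhysics.QuantumFieldTheory.BalabanImbrieJaffe1984to88.BIJ88Expansion5143Gauss (fD)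
open Literature.MathematicalPhysics.QuantumFieldTheory.BalabanImbrieJaffe1984to88.BIJ88SlotMoments308 (zt slotMoment)
open Literature.MathematicalPhysics.QuantumFieldTheory.BalabanImbrieJaffe1984to88.BIJ88SlotMomentsGauss308 (uD continuous_ext
  measurable_ext ext_zero zt_fieldLaw_eq_zG)
open Literature.MathematicalPhysics.QuantumFieldTheory.BalabanImbrieJaffe1984to88.BIJ88SlotCumulants308
  (effectiveAction_eq_pertP_add_remR_ursell)
open Literature.MathematicalPhysics.QuantumFieldTheory.BalabanImbrieJaffe1984to88.BIJ88EffectiveActionGauss308 (hasGaussianLaw_slotFields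
  integral_slotField_fieldLaw measurable_slotField effectiveAction_fieldLaw_eq_pertP_add_remR_Tsum_of_ineq5144)
open Literature.MathematicalPhysics.QuantumFieldTheory.BalabanImbrieJaffe1984to88.BIJ88Expansion5143 (g3 prime)
open Literature.MathematicalPhysics.QuantumFieldTheory.BalabanImbrieJaffe1984to88.BIJ88Expansion5143Ordered (polysOf cvsupp locv wv)
open Literature.MathematicalPhysics.QuantumFieldTheory.BalabanImbrieJaffe1984to88.BIJ88ConnectedGraphResummation (Tsum)
open Literature.MathematicalPhysics.QuantumFieldTheory.BalabanImbrieJaffe1984to88.BIJ88Ineq5113Covering (cubeSys)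
open Literature.MathematicalPhysics.QuantumFieldTheory.BalabanImbrieJaffe1984to88.BIJ88Sect5StatementsPart2 (Ineq5144)
open Literature.MathematicalPhysics.QuantumFieldTheory.BalabanImbrieJaffe1984to88.BIJ88Extraction311 (pert PL W6pp extraction311)
open Literature.MathematicalPhysics.QuantumFieldTheory.BalabanImbrieJaffe1984to88.BIJ88Sect5Statements (CutoffProfile)
open Literature.MathematicalPhysics.QuantumFieldTheory.BalabanImbrieJaffe1984to88.BIJ88Sect5StatementsPart4 (remR pertP)
open Literature.MathematicalPhysics.QuantumFieldTheory.BalabanImbrieJaffe1984to88.BIJ88Eq5145CornerModel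

namespace Literature.MathematicalPhysics.QuantumFieldTheory.BalabanImbrieJaffe1984to88.BIJ88Eq5145CornerUrsell

variable {α I : Type} [Fintype α] [DecidableEq α] [Fintype I] [DecidableEq I]
  (blk : α → I) (Δ : Matrix α α ℝ) (ℱ : α → ℝ)

section Ursell

variable (adj : I → I → Prop) [DecidableRel adj]
variable (χ : CutoffProfile) {ι υ : Type*} [DecidableEq ι] [DecidableEq υ]
variable {p ek : ℝ} {B : Finset ι} {Φ : ι → (α → ℝ) → ℝ} {c : ι → ℝ} {Ys : Finset υ} {V : υ → (α → ℝ) → ℝ}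
variable (cube : ↥B ⊕ ↥Ys → I) {L : Type*} (γ : L → ↥B ⊕ ↥Ys)

/-- **(5.14.5) ON THE MODEL, WITH (5.14.1)–(5.14.2) AT `t = 0` BY NAME**: as `eq5145_zG`, the per-region `hlogz` DISCHARGED by p36 g11's
`effectiveAction_eq_pertP_add_remR_ursell` applied to the region's `z_t` (`zG_fD_empty_eq_ztIn`): `pert := 𝒫̃_{k+1}(Λ₁₂) = pertP(log z_t)`,
`rem := ℛ_k(Λ₁₂) = (n̄+1)·remR(t ↦ Σ_γ uᵀ_{γ,t})` (cumulants of the slot moments). Displayed per region: the slot fields `Φ_b ∘ ext`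
(`□(b) ⊂ Λ₁₂`) are jointly Gaussian and centred under the law of `Λ₁₂` at `1_{Λ₁₂′}` (for the linear fields of the print: p36's announced
`BIJ88EffectiveActionGauss308`), a slot located in each region (`s₀`), `p > 1/2`, `e_k < e^{−1}`, `n̄ + 1` derivative labels; `hrem`
(`ℛ = Σ_X W₆′(X)`, p. 310 display 4) and `h311`. [cite: BalabanImbrieJaffe1988, (5.14.5) p.312; (5.14.1)–(5.14.2) p.308] -/
theorem eq5145_zG_ursell (hΔadj : ∀ x y, blk x ≠ blk y → ¬ adj (blk x) (blk y) → Δ x y = 0) (hΔ : Δ.PosDef)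
    (hχ : ∀ x, 0 ≤ χ.χ₁ x) (hp : 1 / 2 < p) (hΦc : ∀ b ∈ B, Continuous (Φ b)) (hΦ0 : ∀ b ∈ B, Φ b 0 = 0) {c₀ : ℝ} (hc₀ : 0 < c₀)
    (hcb : ∀ b ∈ B, c₀ ≤ c b) (hV : ∀ Y ∈ Ys, Measurable (V Y)) {KY : υ → ℝ} (hK : ∀ Y ∈ Ys, ∀ φ, |V Y φ| ≤ KY Y)
    (hek : 0 < ek) (hek1 : ek < Real.exp (-1))
    (hΦloc : ∀ b : B, ∀ φ ψ : α → ℝ, (∀ x, blk x = cube (Sum.inl b) → φ x = ψ x) → Φ b φ = Φ b ψ)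
    (hVloc : ∀ Y : Ys, ∀ φ ψ : α → ℝ, (∀ x, blk x = cube (Sum.inr Y) → φ x = ψ x) → V Y φ = V Y ψ)
    (F : I → (α → ℝ) → ℝ) (hFloc : ∀ i (φ ψ : α → ℝ), (∀ x, blk x = i → φ x = ψ x) → F i φ = F i ψ)
    {αL : Type*} [Fintype αL] [DecidableEq αL] {nbar : ℕ} (hα : Fintype.card αL = nbar + 1)
    (W Bl : Finset I) {Xt : Type*} (𝒳 : Finset Xt) (Vconst PL : ℝ) (W6p W6pp : Finset (Finset I) → Xt → ℝ)
    (s₀ : (ρ : Finset (Finset I)) → ↥(slotB B Ys cube (lam12 W ρ)) ⊕ ↥(slotY B Ys cube (lam12 W ρ)))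
    (hJ : ∀ ρ ∈ (outer W Bl).filter (IsAdmissible adj),
      HasGaussianLaw (fun ω (b : ↥(slotB B Ys cube (lam12 W ρ))) => Φ b.1 (ext blk (lam12 W ρ) ω))
        (regionLaw blk Δ ℱ (lam12 W ρ) (lam12' adj W ρ)))
    (h0 : ∀ ρ ∈ (outer W Bl).filter (IsAdmissible adj), ∀ b ∈ slotB B Ys cube (lam12 W ρ),
      ∫ ω, Φ b (ext blk (lam12 W ρ) ω) ∂(regionLaw blk Δ ℱ (lam12 W ρ) (lam12' adj W ρ)) = 0)
    (hrem : ∀ ρ ∈ (outer W Bl).filter (IsAdmissible adj),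
      (nbar + 1 : ℝ) * remR (fun t => ∑ γ' : αL → ↥(slotB B Ys cube (lam12 W ρ)) ⊕ ↥(slotY B Ys cube (lam12 W ρ)),
        ursellOf (fun K' => slotMoment χ p ek (slotB B Ys cube (lam12 W ρ)) (fun b ω => Φ b (ext blk (lam12 W ρ) ω))
          (fun b => c b) (slotY B Ys cube (lam12 W ρ)) (fun Y ω => V Y (ext blk (lam12 W ρ) ω))
          (regionLaw blk Δ ℱ (lam12 W ρ) (lam12' adj W ρ)) t K' γ') univ) nbar = ∑ X ∈ 𝒳, W6p ρ X)
    (h311 : ∀ ρ ∈ (outer W Bl).filter (IsAdmissible adj),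
      Vconst + pertP (fun t => Real.log (ztIn blk Δ ℱ χ p ek B Φ c Ys V cube (lam12 W ρ) (lam12' adj W ρ) t)) nbar =
        PL + ∑ X ∈ 𝒳, W6pp ρ X) :
    Real.exp (-Vconst) * expect blk Δ ℱ (fun i φ => fD (uD χ p ek B Φ c Ys V 1) cube γ ∅ i φ * F i φ) W (corner ℝ W) =
      ∑ ρ ∈ (outer W Bl).filter (IsAdmissible adj),
        (∏ X ∈ ρ, g1 adj (zG blk Δ ℱ (fun i φ => fD (uD χ p ek B Φ c Ys V 1) cube γ ∅ i φ * F i φ)) X) *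
          (zG blk Δ ℱ (fun i φ => fD (uD χ p ek B Φ c Ys V 1) cube γ ∅ i φ * F i φ) (lam12 W ρ) (lam12' adj W ρ) /
              zG blk Δ ℱ (fD (uD χ p ek B Φ c Ys V 1) cube γ ∅) (lam12 W ρ) (lam12' adj W ρ) *
            Real.exp (-PL - ∑ X ∈ 𝒳, (W6p ρ X + W6pp ρ X))) := by
  refine eq5145_zG blk Δ ℱ adj χ cube γ hΔadj hΔ hχ (by linarith) hΦc hΦ0 hc₀ hcb hV hK hek hek1.le hΦloc hVloc F hFloc
    W Bl 𝒳 Vconst PL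
    (fun ρ => pertP (fun t => Real.log (ztIn blk Δ ℱ χ p ek B Φ c Ys V cube (lam12 W ρ) (lam12' adj W ρ) t)) nbar)
    (fun ρ => (nbar + 1 : ℝ) * remR (fun t => ∑ γ' : αL → ↥(slotB B Ys cube (lam12 W ρ)) ⊕ ↥(slotY B Ys cube (lam12 W ρ)),
        ursellOf (fun K' => slotMoment χ p ek (slotB B Ys cube (lam12 W ρ)) (fun b ω => Φ b (ext blk (lam12 W ρ) ω))
          (fun b => c b) (slotY B Ys cube (lam12 W ρ)) (fun Y ω => V Y (ext blk (lam12 W ρ) ω))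
          (regionLaw blk Δ ℱ (lam12 W ρ) (lam12' adj W ρ)) t K' γ') univ) nbar)
    W6p W6pp (fun ρ hρ => ?_) hrem h311
  -- (5.14.1)–(5.14.2) at `t = 0` for the region's `z_t`, by name
  haveI := isProbabilityMeasure_regionLaw blk Δ ℱ hΔ (lam12 W ρ) (lam12' adj W ρ)
  have hΦ' : ∀ b ∈ slotB B Ys cube (lam12 W ρ), Measurable fun ω : {x : α // blk x ∈ lam12 W ρ} → ℝ => Φ b (ext blk (lam12 W ρ) ω) :=
    fun b _ => ((hΦc b b.2).comp (continuous_ext blk (lam12 W ρ))).measurable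
  have hV' : ∀ Y ∈ slotY B Ys cube (lam12 W ρ), Measurable fun ω : {x : α // blk x ∈ lam12 W ρ} → ℝ => V Y (ext blk (lam12 W ρ) ω) :=
    fun Y _ => (hV Y Y.2).comp (measurable_ext blk (lam12 W ρ))
  have h14 := (effectiveAction_eq_pertP_add_remR_ursell χ hχ hp (regionLaw blk Δ ℱ (lam12 W ρ) (lam12' adj W ρ))
    (B := slotB B Ys cube (lam12 W ρ)) (Φ := fun b ω => Φ b (ext blk (lam12 W ρ) ω)) (c := fun b => c b)
    (Ys := slotY B Ys cube (lam12 W ρ)) (V := fun Y ω => V Y (ext blk (lam12 W ρ) ω)) (hJ ρ hρ) hΦ' (h0 ρ hρ) hc₀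
    (fun b _ => hcb b b.2) hV' (KY := fun Y => KY Y) (fun Y _ ω => hK Y Y.2 _) hek hek1 hα (s₀ ρ)).1
  rw [zG_fD_empty_eq_ztIn]
  exact h14

variable {S : Type*} {K : Type*} [AddCommGroup K] [Module ℝ K]
variable {D : Type*} [Fintype D] {P : Type*} [DecidableEq P]
variable (m : D → ℕ) (spec : (δ : D) → Fin (m δ) → S) (T : (δ : D) → I → MultilinearMap ℝ (fun _ : Fin (m δ) => K) ℝ)
variable (Cstd : S → K) (pc : Finset I → S → Finset P) (E : Finset I → S → P → K) (reg : P → Finset I) (ord : D → ℕ)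

/-- **… WITH BOTH (5.14.2) AT `t = 0` AND p. 311 BY NAME**: `eq5145_zG_ursell` with `h311` fed by p31's `extraction311` (`𝒫^L := PL`,
`W₆″ := W6pp`, `𝒳 := A.powerset`), modulo the displayed identification `hpert` of the two currencies of `𝒫̃_{k+1}(Λ₁₂)` — (5.14.2)'s
`pertP(log z_t)` (*"𝒫̃_{k+1} = Σ_{α=1}^{n̄} −(1/α!)(d^α/dt^α) log z_t|_{t=0}"*, p. 308) and p31's diagram data `pert` (*"is contained in the
terms of 𝒫̃_{k+1}"*, p. 311). Displayed per region: Gaussianity/centring of the slot fields, `s₀`, `hpert`, `hrem`.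
[cite: BalabanImbrieJaffe1988, (5.14.5) p.312; (5.14.2) p.308; p.311] -/
theorem eq5145_zG_ursell_extraction (hΔadj : ∀ x y, blk x ≠ blk y → ¬ adj (blk x) (blk y) → Δ x y = 0) (hΔ : Δ.PosDef)
    (hχ : ∀ x, 0 ≤ χ.χ₁ x) (hp : 1 / 2 < p) (hΦc : ∀ b ∈ B, Continuous (Φ b)) (hΦ0 : ∀ b ∈ B, Φ b 0 = 0) {c₀ : ℝ} (hc₀ : 0 < c₀)
    (hcb : ∀ b ∈ B, c₀ ≤ c b) (hV : ∀ Y ∈ Ys, Measurable (V Y)) {KY : υ → ℝ} (hK : ∀ Y ∈ Ys, ∀ φ, |V Y φ| ≤ KY Y)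
    (hek : 0 < ek) (hek1 : ek < Real.exp (-1))
    (hΦloc : ∀ b : B, ∀ φ ψ : α → ℝ, (∀ x, blk x = cube (Sum.inl b) → φ x = ψ x) → Φ b φ = Φ b ψ)
    (hVloc : ∀ Y : Ys, ∀ φ ψ : α → ℝ, (∀ x, blk x = cube (Sum.inr Y) → φ x = ψ x) → V Y φ = V Y ψ)
    (F : I → (α → ℝ) → ℝ) (hFloc : ∀ i (φ ψ : α → ℝ), (∀ x, blk x = i → φ x = ψ x) → F i φ = F i ψ)
    {αL : Type*} [Fintype αL] [DecidableEq αL] {nbar : ℕ} (hα : Fintype.card αL = nbar + 1)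
    (W Bl : Finset I) (Vconst : ℝ) (A : Finset I) (hWA : W ⊆ A) (hreg : ∀ W' s, ∀ r ∈ pc W' s, reg r ⊆ A)
    (W6p : Finset (Finset I) → Finset I → ℝ)
    (s₀ : (ρ : Finset (Finset I)) → ↥(slotB B Ys cube (lam12 W ρ)) ⊕ ↥(slotY B Ys cube (lam12 W ρ)))
    (hJ : ∀ ρ ∈ (outer W Bl).filter (IsAdmissible adj),
      HasGaussianLaw (fun ω (b : ↥(slotB B Ys cube (lam12 W ρ))) => Φ b.1 (ext blk (lam12 W ρ) ω))
        (regionLaw blk Δ ℱ (lam12 W ρ) (lam12' adj W ρ)))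
    (h0 : ∀ ρ ∈ (outer W Bl).filter (IsAdmissible adj), ∀ b ∈ slotB B Ys cube (lam12 W ρ),
      ∫ ω, Φ b (ext blk (lam12 W ρ) ω) ∂(regionLaw blk Δ ℱ (lam12 W ρ) (lam12' adj W ρ)) = 0)
    (hpert : ∀ ρ ∈ (outer W Bl).filter (IsAdmissible adj),
      pertP (fun t => Real.log (ztIn blk Δ ℱ χ p ek B Φ c Ys V cube (lam12 W ρ) (lam12' adj W ρ) t)) nbar =
        pert m spec T Cstd (pc (lam12 W ρ)) (E (lam12 W ρ)) (lam12 W ρ))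
    (hrem : ∀ ρ ∈ (outer W Bl).filter (IsAdmissible adj),
      (nbar + 1 : ℝ) * remR (fun t => ∑ γ' : αL → ↥(slotB B Ys cube (lam12 W ρ)) ⊕ ↥(slotY B Ys cube (lam12 W ρ)),
        ursellOf (fun K' => slotMoment χ p ek (slotB B Ys cube (lam12 W ρ)) (fun b ω => Φ b (ext blk (lam12 W ρ) ω))
          (fun b => c b) (slotY B Ys cube (lam12 W ρ)) (fun Y ω => V Y (ext blk (lam12 W ρ) ω))
          (regionLaw blk Δ ℱ (lam12 W ρ) (lam12' adj W ρ)) t K' γ') univ) nbar = ∑ X ∈ A.powerset, W6p ρ X) :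
    Real.exp (-Vconst) * expect blk Δ ℱ (fun i φ => fD (uD χ p ek B Φ c Ys V 1) cube γ ∅ i φ * F i φ) W (corner ℝ W) =
      ∑ ρ ∈ (outer W Bl).filter (IsAdmissible adj),
        (∏ X ∈ ρ, g1 adj (zG blk Δ ℱ (fun i φ => fD (uD χ p ek B Φ c Ys V 1) cube γ ∅ i φ * F i φ)) X) *
          (zG blk Δ ℱ (fun i φ => fD (uD χ p ek B Φ c Ys V 1) cube γ ∅ i φ * F i φ) (lam12 W ρ) (lam12' adj W ρ) /
              zG blk Δ ℱ (fD (uD χ p ek B Φ c Ys V 1) cube γ ∅) (lam12 W ρ) (lam12' adj W ρ) *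
            Real.exp (-PL m spec T Cstd ord nbar Vconst A - ∑ X ∈ A.powerset, (W6p ρ X
              + W6pp m spec T Cstd (pc (lam12 W ρ)) (E (lam12 W ρ)) reg ord nbar A (lam12 W ρ) X))) :=
  eq5145_zG_ursell blk Δ ℱ adj χ cube γ hΔadj hΔ hχ hp hΦc hΦ0 hc₀ hcb hV hK hek hek1 hΦloc hVloc F hFloc hα W Bl A.powerset
    Vconst (PL m spec T Cstd ord nbar Vconst A) W6p
    (fun ρ X => W6pp m spec T Cstd (pc (lam12 W ρ)) (E (lam12 W ρ)) reg ord nbar A (lam12 W ρ) X) s₀ hJ h0 hrem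
    fun ρ hρ => by
      rw [hpert ρ hρ]
      exact extraction311 m spec T Cstd (pc (lam12 W ρ)) (E (lam12 W ρ)) reg ord nbar Vconst ((lam12_subset W ρ).trans hWA) (hreg _)

end Ursell

/-! ## LINEAR slot fields: Gaussianity BY NAME (p36's `hasGaussianLaw_slotFields`), centring = the mean-field condition -/

section Linear

variable (adj : I → I → Prop) [DecidableRel adj]
variable (χ : CutoffProfile) {ι υ : Type*} [DecidableEq ι] [DecidableEq υ]
variable {p ek : ℝ} {B : Finset ι} {Φ : ι → (α → ℝ) → ℝ} {c : ι → ℝ} {Ys : Finset υ} {V : υ → (α → ℝ) → ℝ}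
variable (cube : ↥B ⊕ ↥Ys → I) {L : Type*} (γ : L → ↥B ⊕ ↥Ys)

omit [DecidableEq ι] [DecidableEq υ] in
/-- **the located LINEAR slot fields of a region are jointly Gaussian under the law of the region at any corner** (p36's
`hasGaussianLaw_slotFields` for the resummed form `Δ_{1_Λ}`, `Δ ≻ 0`): the hypothesis `hJ` of `eq5145_zG_ursell` DISCHARGED for the linear
functionals of the print. [cite: BalabanImbrieJaffe1988, (5.14.2) p.308; p.306 (Sect. 5.13)] -/
theorem hasGaussianLaw_slotFields_regionLaw (hΔ : Δ.PosDef) (hlin : ∀ b ∈ B, IsLinearMap ℝ (Φ b)) (X Λ : Finset I) :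
    HasGaussianLaw (fun ω (b : ↥(slotB B Ys cube X)) => Φ b.1 (ext blk X ω)) (regionLaw blk Δ ℱ X Λ) :=
  hasGaussianLaw_slotFields blk (interpForm blk Δ (corner ℝ Λ)) ℱ X (B := slotB B Ys cube X) (Φ := fun b : ↥B => Φ b)
    (prec_interp_corner_posDef blk Δ hΔ X Λ) fun b _ => hlin b b.2

omit [DecidableEq ι] in
/-- **the mean of a located linear slot field under the law of the region `X` at the corner `1_Λ` is its value at the region's mean field**
`(Δ_{1_Λ}|_X)⁻¹ ℱ|_X` (p36's `integral_slotField_fieldLaw` + `prec_interp_corner`). [cite: BalabanImbrieJaffe1988, (5.14.2) p.308; p.305 (Sect. 5.13)] -/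
theorem integral_slotField_regionLaw (hΔ : Δ.PosDef) {b : ι} (hlin : IsLinearMap ℝ (Φ b)) (X Λ : Finset I) :
    ∫ ω, Φ b (ext blk X ω) ∂(regionLaw blk Δ ℱ X Λ) = Φ b (ext blk X ((prec blk Δ X (corner ℝ Λ))⁻¹.mulVec (src blk ℱ X))) := by
  rw [← prec_interp_corner blk Δ X Λ]
  exact integral_slotField_fieldLaw blk (interpForm blk Δ (corner ℝ Λ)) ℱ X (prec_interp_corner_posDef blk Δ hΔ X Λ) hlin

/-- **(5.14.5) ON THE MODEL FOR THE LINEAR SLOT FIELDS OF THE PRINT — (5.13.4), (5.14.1), (5.14.2) at `t = 0`, *"z_F = (z_F/z)·z"*, `z > 0` AND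
THE GAUSSIANITY OF THE SLOT FIELDS ALL BY NAME / PROVED**: `eq5145_zG_ursell` with `hJ` discharged (`hasGaussianLaw_slotFields_regionLaw`) and the
centring reduced to the MEAN-FIELD CONDITION `hcen : Φ_b((Δ_{1_{Λ₁₂′}}|_{Λ₁₂})⁻¹ ℱ|_{Λ₁₂}) = 0` for the slots of `Λ₁₂` (p36's `hcen`; automatic for
`ℱ = 0`, next theorem). Displayed per region: `s₀` (a slot in the region), `hcen`, `hrem` (`ℛ = Σ_X W₆′(X)`), `h311`.
[cite: BalabanImbrieJaffe1988, (5.14.5) p.312; (5.14.1)–(5.14.2) p.308] -/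
theorem eq5145_zG_linear (hΔadj : ∀ x y, blk x ≠ blk y → ¬ adj (blk x) (blk y) → Δ x y = 0) (hΔ : Δ.PosDef)
    (hχ : ∀ x, 0 ≤ χ.χ₁ x) (hp : 1 / 2 < p) (hlin : ∀ b ∈ B, IsLinearMap ℝ (Φ b)) {c₀ : ℝ} (hc₀ : 0 < c₀)
    (hcb : ∀ b ∈ B, c₀ ≤ c b) (hV : ∀ Y ∈ Ys, Measurable (V Y)) {KY : υ → ℝ} (hK : ∀ Y ∈ Ys, ∀ φ, |V Y φ| ≤ KY Y)
    (hek : 0 < ek) (hek1 : ek < Real.exp (-1))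
    (hΦloc : ∀ b : B, ∀ φ ψ : α → ℝ, (∀ x, blk x = cube (Sum.inl b) → φ x = ψ x) → Φ b φ = Φ b ψ)
    (hVloc : ∀ Y : Ys, ∀ φ ψ : α → ℝ, (∀ x, blk x = cube (Sum.inr Y) → φ x = ψ x) → V Y φ = V Y ψ)
    (F : I → (α → ℝ) → ℝ) (hFloc : ∀ i (φ ψ : α → ℝ), (∀ x, blk x = i → φ x = ψ x) → F i φ = F i ψ)
    {αL : Type*} [Fintype αL] [DecidableEq αL] {nbar : ℕ} (hα : Fintype.card αL = nbar + 1)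
    (W Bl : Finset I) {Xt : Type*} (𝒳 : Finset Xt) (Vconst PL : ℝ) (W6p W6pp : Finset (Finset I) → Xt → ℝ)
    (s₀ : (ρ : Finset (Finset I)) → ↥(slotB B Ys cube (lam12 W ρ)) ⊕ ↥(slotY B Ys cube (lam12 W ρ)))
    (hcen : ∀ ρ ∈ (outer W Bl).filter (IsAdmissible adj), ∀ b ∈ slotB B Ys cube (lam12 W ρ),
      Φ b (ext blk (lam12 W ρ) ((prec blk Δ (lam12 W ρ) (corner ℝ (lam12' adj W ρ)))⁻¹.mulVec (src blk ℱ (lam12 W ρ)))) = 0)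
    (hrem : ∀ ρ ∈ (outer W Bl).filter (IsAdmissible adj),
      (nbar + 1 : ℝ) * remR (fun t => ∑ γ' : αL → ↥(slotB B Ys cube (lam12 W ρ)) ⊕ ↥(slotY B Ys cube (lam12 W ρ)),
        ursellOf (fun K' => slotMoment χ p ek (slotB B Ys cube (lam12 W ρ)) (fun b ω => Φ b (ext blk (lam12 W ρ) ω))
          (fun b => c b) (slotY B Ys cube (lam12 W ρ)) (fun Y ω => V Y (ext blk (lam12 W ρ) ω))
          (regionLaw blk Δ ℱ (lam12 W ρ) (lam12' adj W ρ)) t K' γ') univ) nbar = ∑ X ∈ 𝒳, W6p ρ X)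
    (h311 : ∀ ρ ∈ (outer W Bl).filter (IsAdmissible adj),
      Vconst + pertP (fun t => Real.log (ztIn blk Δ ℱ χ p ek B Φ c Ys V cube (lam12 W ρ) (lam12' adj W ρ) t)) nbar =
        PL + ∑ X ∈ 𝒳, W6pp ρ X) :
    Real.exp (-Vconst) * expect blk Δ ℱ (fun i φ => fD (uD χ p ek B Φ c Ys V 1) cube γ ∅ i φ * F i φ) W (corner ℝ W) =
      ∑ ρ ∈ (outer W Bl).filter (IsAdmissible adj),
        (∏ X ∈ ρ, g1 adj (zG blk Δ ℱ (fun i φ => fD (uD χ p ek B Φ c Ys V 1) cube γ ∅ i φ * F i φ)) X) *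
          (zG blk Δ ℱ (fun i φ => fD (uD χ p ek B Φ c Ys V 1) cube γ ∅ i φ * F i φ) (lam12 W ρ) (lam12' adj W ρ) /
              zG blk Δ ℱ (fD (uD χ p ek B Φ c Ys V 1) cube γ ∅) (lam12 W ρ) (lam12' adj W ρ) *
            Real.exp (-PL - ∑ X ∈ 𝒳, (W6p ρ X + W6pp ρ X))) :=
  eq5145_zG_ursell blk Δ ℱ adj χ cube γ hΔadj hΔ hχ hp
    (fun b hb => LinearMap.continuous_of_finiteDimensional ((hlin b hb).mk' (Φ b)))
    (fun b hb => ((hlin b hb).mk' (Φ b)).map_zero) hc₀ hcb hV hK hek hek1 hΦloc hVloc F hFloc hα W Bl 𝒳 Vconst PL W6p W6pp s₀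
    (fun ρ _ => hasGaussianLaw_slotFields_regionLaw blk Δ ℱ cube hΔ hlin (lam12 W ρ) (lam12' adj W ρ))
    (fun ρ hρ b hb => (integral_slotField_regionLaw blk Δ ℱ hΔ (hlin b b.2) (lam12 W ρ) (lam12' adj W ρ)).trans (hcen ρ hρ b hb))
    hrem h311

/-- **… AND WITHOUT A LINEAR SOURCE (`ℱ = 0`) THE CENTRING IS AUTOMATIC**: `eq5145_zG_linear` for `ℱ = 0`, `hcen` discharged (the mean field
vanishes). Displayed per region: `s₀`, `hrem`, `h311` only. [cite: BalabanImbrieJaffe1988, (5.14.5) p.312; (5.14.1)–(5.14.2) p.308] -/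
theorem eq5145_zG_linear_noSource (hΔadj : ∀ x y, blk x ≠ blk y → ¬ adj (blk x) (blk y) → Δ x y = 0) (hΔ : Δ.PosDef)
    (hχ : ∀ x, 0 ≤ χ.χ₁ x) (hp : 1 / 2 < p) (hlin : ∀ b ∈ B, IsLinearMap ℝ (Φ b)) {c₀ : ℝ} (hc₀ : 0 < c₀)
    (hcb : ∀ b ∈ B, c₀ ≤ c b) (hV : ∀ Y ∈ Ys, Measurable (V Y)) {KY : υ → ℝ} (hK : ∀ Y ∈ Ys, ∀ φ, |V Y φ| ≤ KY Y)
    (hek : 0 < ek) (hek1 : ek < Real.exp (-1))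
    (hΦloc : ∀ b : B, ∀ φ ψ : α → ℝ, (∀ x, blk x = cube (Sum.inl b) → φ x = ψ x) → Φ b φ = Φ b ψ)
    (hVloc : ∀ Y : Ys, ∀ φ ψ : α → ℝ, (∀ x, blk x = cube (Sum.inr Y) → φ x = ψ x) → V Y φ = V Y ψ)
    (F : I → (α → ℝ) → ℝ) (hFloc : ∀ i (φ ψ : α → ℝ), (∀ x, blk x = i → φ x = ψ x) → F i φ = F i ψ)
    {αL : Type*} [Fintype αL] [DecidableEq αL] {nbar : ℕ} (hα : Fintype.card αL = nbar + 1)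
    (W Bl : Finset I) {Xt : Type*} (𝒳 : Finset Xt) (Vconst PL : ℝ) (W6p W6pp : Finset (Finset I) → Xt → ℝ)
    (s₀ : (ρ : Finset (Finset I)) → ↥(slotB B Ys cube (lam12 W ρ)) ⊕ ↥(slotY B Ys cube (lam12 W ρ)))
    (hrem : ∀ ρ ∈ (outer W Bl).filter (IsAdmissible adj),
      (nbar + 1 : ℝ) * remR (fun t => ∑ γ' : αL → ↥(slotB B Ys cube (lam12 W ρ)) ⊕ ↥(slotY B Ys cube (lam12 W ρ)),
        ursellOf (fun K' => slotMoment χ p ek (slotB B Ys cube (lam12 W ρ)) (fun b ω => Φ b (ext blk (lam12 W ρ) ω))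
          (fun b => c b) (slotY B Ys cube (lam12 W ρ)) (fun Y ω => V Y (ext blk (lam12 W ρ) ω))
          (regionLaw blk Δ (0 : α → ℝ) (lam12 W ρ) (lam12' adj W ρ)) t K' γ') univ) nbar = ∑ X ∈ 𝒳, W6p ρ X)
    (h311 : ∀ ρ ∈ (outer W Bl).filter (IsAdmissible adj),
      Vconst + pertP (fun t => Real.log (ztIn blk Δ (0 : α → ℝ) χ p ek B Φ c Ys V cube (lam12 W ρ) (lam12' adj W ρ) t)) nbar =
        PL + ∑ X ∈ 𝒳, W6pp ρ X) :
    Real.exp (-Vconst) * expect blk Δ (0 : α → ℝ) (fun i φ => fD (uD χ p ek B Φ c Ys V 1) cube γ ∅ i φ * F i φ) W (corner ℝ W) =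
      ∑ ρ ∈ (outer W Bl).filter (IsAdmissible adj),
        (∏ X ∈ ρ, g1 adj (zG blk Δ (0 : α → ℝ) (fun i φ => fD (uD χ p ek B Φ c Ys V 1) cube γ ∅ i φ * F i φ)) X) *
          (zG blk Δ (0 : α → ℝ) (fun i φ => fD (uD χ p ek B Φ c Ys V 1) cube γ ∅ i φ * F i φ) (lam12 W ρ) (lam12' adj W ρ) /
              zG blk Δ (0 : α → ℝ) (fD (uD χ p ek B Φ c Ys V 1) cube γ ∅) (lam12 W ρ) (lam12' adj W ρ) *
            Real.exp (-PL - ∑ X ∈ 𝒳, (W6p ρ X + W6pp ρ X))) := by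
  refine eq5145_zG_linear blk Δ 0 adj χ cube γ hΔadj hΔ hχ hp hlin hc₀ hcb hV hK hek hek1 hΦloc hVloc F hFloc hα W Bl 𝒳 Vconst PL
    W6p W6pp s₀ (fun ρ _ b _ => ?_) hrem h311
  have h0 : src blk (0 : α → ℝ) (lam12 W ρ) = 0 := by funext x; rfl
  rw [h0, Matrix.mulVec_zero, ext_zero]
  exact ((hlin b b.2).mk' (Φ b)).map_zero

end Linear

section Tsum

variable (adj : I → I → Prop) [DecidableRel adj]
variable (χ : CutoffProfile) {ι υ : Type*} [DecidableEq ι] [DecidableEq υ]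
variable {p ek : ℝ} {B : Finset ι} {Φ : ι → (α → ℝ) → ℝ} {c : ι → ℝ} {Ys : Finset υ} {V : υ → (α → ℝ) → ℝ}
variable (cube : ↥B ⊕ ↥Ys → I) {L : Type*} (γ : L → ↥B ⊕ ↥Ys)

/-- **the cube map of the slots located in the region `X`** (restriction of `cube`). [cite: BalabanImbrieJaffe1988, (5.14.3) p.309] -/
abbrev cubeIn (X : Finset I) : ↥(slotB B Ys cube X) ⊕ ↥(slotY B Ys cube X) → I :=
  Sum.elim (fun b => cube (Sum.inl b.1)) (fun Y => cube (Sum.inr Y.1))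

omit [Fintype I] [DecidableEq ι] [DecidableEq υ] in
/-- every located slot's cube lies in the region. [cite: BalabanImbrieJaffe1988, (5.14.2)–(5.14.3) pp.308–309] -/
theorem cubeIn_mem (X : Finset I) (τ : ↥(slotB B Ys cube X) ⊕ ↥(slotY B Ys cube X)) : cubeIn cube X τ ∈ X := by
  rcases τ with b | Y
  · exact (mem_slotB B Ys cube X b.1).1 b.2
  · exact (mem_slotY B Ys cube X Y.1).1 Y.2

omit [DecidableRel adj] in
/-- the resummed form `Δ_{1_Λ}` couples only the pairs of cubes `Δ` couples (abutting cubes only). [cite: BalabanImbrieJaffe1988, p.305 (Sect. 5.13)] -/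
theorem interpForm_abutting (hΔadj : ∀ x y, blk x ≠ blk y → ¬ adj (blk x) (blk y) → Δ x y = 0) (Λ : Finset I) (x y : α)
    (hxy : blk x ≠ blk y) (hna : ¬ adj (blk x) (blk y)) : interpForm blk Δ (corner ℝ Λ) x y = 0 := by
  rw [interpForm_apply, if_neg hxy, hΔadj x y hxy hna, mul_zero]

/-- **the region's `z_t` in p36's F5 currency**: `z_t(X)(Λ) = ⟨Π_{i∈X} fD_t ∅ i⟩_{1_X,X}[Δ_{1_Λ}]` for the located slot data and the located
cube map (p36's `zt_fieldLaw_eq_zG` for the region). [cite: BalabanImbrieJaffe1988, (5.14.2)–(5.14.3) pp.308–309] -/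
theorem ztIn_eq_zG_located (X Λ : Finset I) {L' : Type*} (γ' : L' → ↥(slotB B Ys cube X) ⊕ ↥(slotY B Ys cube X)) (t : ℝ) :
    ztIn blk Δ ℱ χ p ek B Φ c Ys V cube X Λ t =
      zG blk (interpForm blk Δ (corner ℝ Λ)) ℱ (fD (uD χ p ek (slotB B Ys cube X) (fun b : ↥B => Φ b) (fun b : ↥B => c b)
        (slotY B Ys cube X) (fun Y : ↥Ys => V Y) t) (cubeIn cube X) γ' ∅) X X :=
  zt_fieldLaw_eq_zG blk (interpForm blk Δ (corner ℝ Λ)) ℱ X χ p ek (slotB B Ys cube X) (fun b : ↥B => Φ b) (fun b : ↥B => c b)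
    (slotY B Ys cube X) (fun Y : ↥Ys => V Y) (cubeIn cube X) (cubeIn_mem cube X) γ' t

/-- **(5.14.5) ON THE MODEL, LINEAR SLOT FIELDS, WITH THE REMAINDER AS THE CONNECTED-GRAPH SERIES OF DISPLAY 3 MODULO THE LEAF (5.14.4)**:
`eq5145_zG` with, per region `Λ₁₂` at `1_{Λ₁₂′}`, `hlogz` DISCHARGED by p36 g12's `effectiveAction_fieldLaw_eq_pertP_add_remR_Tsum_of_ineq5144`
for the located slot data (`slotB`, `slotY`, `cubeIn`) and the resummed form `Δ_{1_{Λ₁₂′}}`: `pert := pertP(log z_t)`,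
`rem := (n̄+1)·remR(t ↦ Σ_γ T_{γ,t}(L))`, `T` = p25's `Tsum` of display 3 over the virtual supports of the region. Displayed per region: `s₀`, the
mean-field condition `hcen`, THE LEAF (5.14.4) for the prime-dropped activities of every assignment at every `t ∈ (0,1]` (`h5144`, r16's typed
`Ineq5144`, in gen 5's regime: symmetric `adj` of degree `≤ D`, `0 < θ ≤ 1`, `0 ≤ β′`, `16(D+1)²θ^{β′/2}e² ≤ 1`), `hrem` (display 4:
`(n̄+1)·remR(Σ_γ T) = Σ_X W₆′(X)`) and `h311`. [cite: BalabanImbrieJaffe1988, (5.14.5) p.312; (5.14.2) p.308; p.310 displays 3–4; (5.14.4) p.309] -/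
theorem eq5145_zG_linear_Tsum_of_ineq5144 {nbr : I → Finset I} {D : ℕ} {θ β' : ℝ} (hR : ∀ x y, adj x y → adj y x)
    (hD : ∀ x, (nbr x).card ≤ D) (hnbr : ∀ x y, adj x y → y ∈ nbr x) (hθ0 : 0 < θ) (hθ1 : θ ≤ 1) (hβ : 0 ≤ β')
    (hsmall : 16 * ((D : ℝ) + 1) ^ 2 * (θ ^ (β' / 2) * Real.exp 2) ≤ 1)
    (hΔadj : ∀ x y, blk x ≠ blk y → ¬ adj (blk x) (blk y) → Δ x y = 0) (hΔ : Δ.PosDef)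
    (hχ : ∀ x, 0 ≤ χ.χ₁ x) (hp : 1 / 2 < p) (hlin : ∀ b ∈ B, IsLinearMap ℝ (Φ b)) {c₀ : ℝ} (hc₀ : 0 < c₀)
    (hcb : ∀ b ∈ B, c₀ ≤ c b) (hV : ∀ Y ∈ Ys, Measurable (V Y)) {KY : υ → ℝ} (hK : ∀ Y ∈ Ys, ∀ φ, |V Y φ| ≤ KY Y)
    (hek : 0 < ek) (hek1 : ek < Real.exp (-1))
    (hΦloc : ∀ b : B, ∀ φ ψ : α → ℝ, (∀ x, blk x = cube (Sum.inl b) → φ x = ψ x) → Φ b φ = Φ b ψ)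
    (hVloc : ∀ Y : Ys, ∀ φ ψ : α → ℝ, (∀ x, blk x = cube (Sum.inr Y) → φ x = ψ x) → V Y φ = V Y ψ)
    (F : I → (α → ℝ) → ℝ) (hFloc : ∀ i (φ ψ : α → ℝ), (∀ x, blk x = i → φ x = ψ x) → F i φ = F i ψ)
    {L' : Type} [Fintype L'] [DecidableEq L'] {nbar : ℕ} (hL : Fintype.card L' = nbar + 1)
    (W Bl : Finset I) {Xt : Type*} (𝒳 : Finset Xt) (Vconst PL : ℝ) (W6p W6pp : Finset (Finset I) → Xt → ℝ)
    (s₀ : (ρ : Finset (Finset I)) → ↥(slotB B Ys cube (lam12 W ρ)) ⊕ ↥(slotY B Ys cube (lam12 W ρ)))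
    (hcen : ∀ ρ ∈ (outer W Bl).filter (IsAdmissible adj), ∀ b ∈ slotB B Ys cube (lam12 W ρ),
      Φ b (ext blk (lam12 W ρ) ((prec blk Δ (lam12 W ρ) (corner ℝ (lam12' adj W ρ)))⁻¹.mulVec (src blk ℱ (lam12 W ρ)))) = 0)
    (h5144 : ∀ ρ ∈ (outer W Bl).filter (IsAdmissible adj), ∀ t ∈ Set.Ioc (0 : ℝ) 1,
      ∀ γ' : L' → ↥(slotB B Ys cube (lam12 W ρ)) ⊕ ↥(slotY B Ys cube (lam12 W ρ)),
      Ineq5144 (cubeSys I) (Finset L')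
        (prime (g3 adj fun H' => zG blk (interpForm blk Δ (corner ℝ (lam12' adj W ρ))) ℱ
          (fD (uD χ p ek (slotB B Ys cube (lam12 W ρ)) (fun b : ↥B => Φ b) (fun b : ↥B => c b) (slotY B Ys cube (lam12 W ρ))
            (fun Y : ↥Ys => V Y) t) (cubeIn cube (lam12 W ρ)) γ' H')))
        Finset.card (fun H (X' : Finset I) => (X' \ H.image (cubeIn cube (lam12 W ρ) ∘ γ')).card) θ β')
    (hrem : ∀ ρ ∈ (outer W Bl).filter (IsAdmissible adj),
      (nbar + 1 : ℝ) * remR (fun t => ∑ γ' : L' → ↥(slotB B Ys cube (lam12 W ρ)) ⊕ ↥(slotY B Ys cube (lam12 W ρ)),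
        Tsum ((polysOf (lam12 W ρ)).image (cvsupp adj (lam12 W ρ))) (locv (cubeIn cube (lam12 W ρ) ∘ γ'))
          (wv (prime (g3 adj fun H' => zG blk (interpForm blk Δ (corner ℝ (lam12' adj W ρ))) ℱ
            (fD (uD χ p ek (slotB B Ys cube (lam12 W ρ)) (fun b : ↥B => Φ b) (fun b : ↥B => c b) (slotY B Ys cube (lam12 W ρ))
              (fun Y : ↥Ys => V Y) t) (cubeIn cube (lam12 W ρ)) γ' H')))) univ) nbar = ∑ X' ∈ 𝒳, W6p ρ X')
    (h311 : ∀ ρ ∈ (outer W Bl).filter (IsAdmissible adj),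
      Vconst + pertP (fun t => Real.log (ztIn blk Δ ℱ χ p ek B Φ c Ys V cube (lam12 W ρ) (lam12' adj W ρ) t)) nbar =
        PL + ∑ X' ∈ 𝒳, W6pp ρ X') :
    Real.exp (-Vconst) * expect blk Δ ℱ (fun i φ => fD (uD χ p ek B Φ c Ys V 1) cube γ ∅ i φ * F i φ) W (corner ℝ W) =
      ∑ ρ ∈ (outer W Bl).filter (IsAdmissible adj),
        (∏ X ∈ ρ, g1 adj (zG blk Δ ℱ (fun i φ => fD (uD χ p ek B Φ c Ys V 1) cube γ ∅ i φ * F i φ)) X) *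
          (zG blk Δ ℱ (fun i φ => fD (uD χ p ek B Φ c Ys V 1) cube γ ∅ i φ * F i φ) (lam12 W ρ) (lam12' adj W ρ) /
              zG blk Δ ℱ (fD (uD χ p ek B Φ c Ys V 1) cube γ ∅) (lam12 W ρ) (lam12' adj W ρ) *
            Real.exp (-PL - ∑ X' ∈ 𝒳, (W6p ρ X' + W6pp ρ X'))) := by
  refine eq5145_zG blk Δ ℱ adj χ cube γ hΔadj hΔ hχ (by linarith)
    (fun b hb => LinearMap.continuous_of_finiteDimensional ((hlin b hb).mk' (Φ b)))
    (fun b hb => ((hlin b hb).mk' (Φ b)).map_zero) hc₀ hcb hV hK hek hek1.le hΦloc hVloc F hFloc W Bl 𝒳 Vconst PL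
    (fun ρ => pertP (fun t => Real.log (ztIn blk Δ ℱ χ p ek B Φ c Ys V cube (lam12 W ρ) (lam12' adj W ρ) t)) nbar)
    (fun ρ => (nbar + 1 : ℝ) * remR (fun t => ∑ γ' : L' → ↥(slotB B Ys cube (lam12 W ρ)) ⊕ ↥(slotY B Ys cube (lam12 W ρ)),
        Tsum ((polysOf (lam12 W ρ)).image (cvsupp adj (lam12 W ρ))) (locv (cubeIn cube (lam12 W ρ) ∘ γ'))
          (wv (prime (g3 adj fun H' => zG blk (interpForm blk Δ (corner ℝ (lam12' adj W ρ))) ℱ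
            (fD (uD χ p ek (slotB B Ys cube (lam12 W ρ)) (fun b : ↥B => Φ b) (fun b : ↥B => c b) (slotY B Ys cube (lam12 W ρ))
              (fun Y : ↥Ys => V Y) t) (cubeIn cube (lam12 W ρ)) γ' H')))) univ) nbar)
    W6p W6pp (fun ρ hρ => ?_) hrem h311
  -- p36's F5 for the located slot data of the region `Λ₁₂ = lam12 W ρ` and the form `Δ_{1_{Λ₁₂′}}`
  have hPD := prec_interp_corner_posDef blk Δ hΔ (lam12 W ρ) (lam12' adj W ρ)
  have hcen' : ∀ b ∈ slotB B Ys cube (lam12 W ρ), (fun b : ↥B => Φ b) b (ext blk (lam12 W ρ)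
      ((prec blk (interpForm blk Δ (corner ℝ (lam12' adj W ρ))) (lam12 W ρ) (corner ℝ (lam12 W ρ)))⁻¹.mulVec
        (src blk ℱ (lam12 W ρ)))) = 0 := fun b hb => by
    rw [prec_interp_corner]
    exact hcen ρ hρ b hb
  have h14 := (effectiveAction_fieldLaw_eq_pertP_add_remR_Tsum_of_ineq5144 blk (interpForm blk Δ (corner ℝ (lam12' adj W ρ))) ℱ
    (lam12 W ρ) adj χ (B := slotB B Ys cube (lam12 W ρ)) (Φ := fun b : ↥B => Φ b) (c := fun b : ↥B => c b)
    (Ys := slotY B Ys cube (lam12 W ρ)) (V := fun Y : ↥Ys => V Y) (cubeIn cube (lam12 W ρ)) hR hD hnbr hθ0 hθ1 hβ hsmall hχ hp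
    (interpForm_abutting blk Δ adj hΔadj (lam12' adj W ρ)) hPD (cubeIn_mem cube (lam12 W ρ)) (fun b φ ψ h => hΦloc b.1 φ ψ h)
    (fun Y φ ψ h => hVloc Y.1 φ ψ h) (fun b _ => hlin b b.2) hcen' hc₀ (fun b _ => hcb b b.2) (fun Y _ => hV Y Y.2)
    (KY := fun Y => KY Y) (fun Y _ φ => hK Y Y.2 φ) hek hek1 hL (s₀ ρ) (fun _ => s₀ ρ) (h5144 ρ hρ)).1
  have hbr : ∀ t, ztIn blk Δ ℱ χ p ek B Φ c Ys V cube (lam12 W ρ) (lam12' adj W ρ) t = _ :=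
    fun t => ztIn_eq_zG_located blk Δ ℱ χ cube (lam12 W ρ) (lam12' adj W ρ) (fun _ : L' => s₀ ρ) t
  rw [zG_fD_empty_eq_ztIn]
  simp only [hbr]
  exact h14

end Tsum

end Literature.MathematicalPhysics.QuantumFieldTheory.BalabanImbrieJaffe1984to88.BIJ88Eq5145CornerUrsell

end
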